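import Literature.Analysis.Hypoelliptic.FiniteOrder
import HarnessLib

/-!
# Finite order, uniformly on a compact set

Analysis/Hypoelliptic support file serving the discharge of
`Literature.Analysis.Distribution.Hormander1967_thm11`: the uniform version of
`FiniteOrder.exists_fourierSide` — for a fixed compact `K ⊆ Ω` there is ONE `M` such that
for every cutoff `ζ` supported in `K` the localized distribution `ζ u` has a Fourier-side
function in `Ĥ^{-M}` (`exists_fourierSide_unif`). This is what the bootstrap over families of
cutoffs needs.

## References

* L. Hörmander, *The Analysis of Linear Partial Differential Operators I*, Thm 2.1.4 / §7.1
  (folklore).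
-/

noncomputable section

open MeasureTheory Set Filter Function SchwartzMap TopologicalSpace Distributions TestFunction
open scoped ENNReal NNReal Topology ComplexConjugate InnerProductSpace FourierTransform BigOperators
  ContDiff BoundedContinuousFunction

namespace Literature.Analysis.Hypoelliptic

variable {E : Type*} [NormedAddCommGroup E] [NormedSpace ℝ E] {Ω : Opens E}
variable {V : Type*} [NormedAddCommGroup V] [InnerProductSpace ℝ V] [FiniteDimensional ℝ V]
  [MeasurableSpace V] [BorelSpace V]

/-- `ζ · g` as an element of `𝓓_K` for any compact `K ⊇ tsupport ζ`. [folklore] -/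
def toK' (K : Compacts E) (ζ : 𝓓(Ω, ℝ)) (hζ : tsupport (ζ : E → ℝ) ⊆ K) (g : E → ℝ)
    (hg : ContDiff ℝ ∞ g) : 𝓓_{K}(E, ℝ) :=
  ⟨fun x => ζ x * g x, ζ.contDiff.mul hg, fun x hx => by
    have : ζ x = 0 := image_eq_zero_of_notMem_tsupport fun h => hx (hζ h)
    simp [this]⟩

/-- `ofSupportedIn (toK' K ζ g) = mulSmooth ζ g`. [folklore] -/
theorem ofSupportedIn_toK' {K : Compacts E} (hK : (K : Set E) ⊆ Ω) (ζ : 𝓓(Ω, ℝ))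
    (hζ : tsupport (ζ : E → ℝ) ⊆ K) (g : E → ℝ) (hg : ContDiff ℝ ∞ g) :
    ofSupportedIn hK (toK' K ζ hζ g hg) = mulSmooth ζ g hg := by
  ext x; rfl

/-- **Seminorm bound in `𝓓_K`**: `N_{K,i}(ζ · ℓ(𝓕ψ ∘ T)) ≤ D_i ‖ψ‖_{i + r}`. [folklore] -/
theorem seminorm_toK'_compF_le {K : Compacts E} (ζ : 𝓓(Ω, ℝ)) (hζ : tsupport (ζ : E → ℝ) ⊆ K)
    (T : E →L[ℝ] V) (ℓ : ℂ →L[ℝ] ℝ) {r : ℝ} (hr : (Module.finrank ℝ V : ℝ) < 2 * r) (i : ℕ) :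
    ∃ D : ℝ, 0 ≤ D ∧ ∀ ψ : 𝓢(V, ℂ),
      (N[ℝ]_{K, i} (toK' K ζ hζ (compF T ℓ ψ) (contDiff_compF T ℓ ψ)) : ℝ) ≤
        D * rn ((i : ℝ) + r) (ψ : V → ℂ) := by
  choose C hC0 hC using fun k : ℕ => norm_iteratedFDeriv_fourier_le_rn (V := V) hr k
  set Z : ℕ → ℝ := fun m => (N[ℝ]_{suppK ζ, m} (selfK ζ) : ℝ) with hZ
  have hZ0 : ∀ m, 0 ≤ Z m := fun m => apply_nonneg _ _
  set D : ℝ := ∑ m ∈ Finset.range (i + 1), (i.choose m : ℝ) * Z m * (‖ℓ‖ * ‖T‖ ^ (i - m) * C (i - m))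
    with hD
  have hD0 : 0 ≤ D := Finset.sum_nonneg fun m _ => by have := hZ0 m; have := hC0 (i - m); positivity
  refine ⟨D, hD0, fun ψ => ?_⟩
  have hψ := SchwartzMap.nice ψ
  refine (ContDiffMapSupportedIn.seminorm_top_le_iff ℝ (mul_nonneg hD0 (rn_nonneg _ _)) i _).2
    fun x _ => ?_
  have hg := contDiff_compF T ℓ ψ
  have hmul := norm_iteratedFDeriv_mul_le (ζ.contDiff) hg x (n := i) (mod_cast le_top)
  change ‖iteratedFDeriv ℝ i (fun y => ζ y * compF T ℓ ψ y) x‖ ≤ _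
  refine hmul.trans ?_
  rw [hD, Finset.sum_mul]
  refine Finset.sum_le_sum fun m hm => ?_
  have h1 : ‖iteratedFDeriv ℝ m ζ x‖ ≤ Z m :=
    ContDiffMapSupportedIn.norm_iteratedFDeriv_apply_le_seminorm ℝ (f := selfK ζ) le_top
  have h2 : ‖iteratedFDeriv ℝ (i - m) (compF T ℓ ψ) x‖ ≤
      ‖ℓ‖ * ‖T‖ ^ (i - m) * C (i - m) * rn ((i : ℝ) + r) (ψ : V → ℂ) := by
    refine (norm_iteratedFDeriv_compF_le T ℓ ψ (i - m) x).trans ?_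
    have h3 := hC (i - m) ψ (T x)
    have h4 : rn (((i - m : ℕ) : ℝ) + r) (ψ : V → ℂ) ≤ rn ((i : ℝ) + r) (ψ : V → ℂ) := by
      refine rn_mono ?_ hψ
      have : ((i - m : ℕ) : ℝ) ≤ (i : ℝ) := by exact_mod_cast Nat.sub_le i m
      linarith
    have := hC0 (i - m)
    calc ‖ℓ‖ * ‖T‖ ^ (i - m) * ‖iteratedFDeriv ℝ (i - m) (𝓕 (ψ : V → ℂ)) (T x)‖
        ≤ ‖ℓ‖ * ‖T‖ ^ (i - m) * (C (i - m) * rn ((i : ℝ) + r) (ψ : V → ℂ)) :=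
          mul_le_mul_of_nonneg_left (h3.trans (mul_le_mul_of_nonneg_left h4 this)) (by positivity)
      _ = _ := by ring
  have := hZ0 m; have := hC0 (i - m); have := rn_nonneg ((i : ℝ) + r) (ψ : V → ℂ)
  calc (i.choose m : ℝ) * ‖iteratedFDeriv ℝ m ζ x‖ * ‖iteratedFDeriv ℝ (i - m) (compF T ℓ ψ) x‖
      ≤ (i.choose m : ℝ) * Z m * (‖ℓ‖ * ‖T‖ ^ (i - m) * C (i - m) * rn ((i : ℝ) + r) (ψ : V → ℂ)) :=
        mul_le_mul (mul_le_mul_of_nonneg_left h1 (Nat.cast_nonneg _)) h2 (norm_nonneg _) (by positivity)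
    _ = _ := by ring

/-- **Uniform bound of the Fourier-side functionals**: one `M` for all cutoffs supported in `K`.
[folklore] -/
theorem norm_fourierFun_le_unif (u : 𝓓'(Ω, ℝ)) (K : Compacts E) (hK : (K : Set E) ⊆ Ω)
    (T : E →L[ℝ] V) : ∃ M : ℝ, ∀ ζ : 𝓓(Ω, ℝ), tsupport (ζ : E → ℝ) ⊆ K →
      ∃ C : ℝ, 0 ≤ C ∧ ∀ ψ : 𝓢(V, ℂ), ‖fourierFun u ζ T ψ‖ ≤ C * rn M (ψ : V → ℂ) := by
  obtain ⟨N, Cu, hCu, hu⟩ := Distribution.exists_finiteOrder u K hK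
  set r : ℝ := (Module.finrank ℝ V : ℝ) / 2 + 1 with hr
  have hr' : (Module.finrank ℝ V : ℝ) < 2 * r := by rw [hr]; linarith
  refine ⟨(N : ℝ) + r, fun ζ hζ => ?_⟩
  choose Dr hDr0 hDr using fun i => seminorm_toK'_compF_le ζ hζ T Complex.reCLM hr' i
  choose Di hDi0 hDi using fun i => seminorm_toK'_compF_le ζ hζ T Complex.imCLM hr' i
  refine ⟨Cu * ∑ i ∈ Finset.range (N + 1), (Dr i + Di i),
    mul_nonneg hCu (Finset.sum_nonneg fun i _ => add_nonneg (hDr0 i) (hDi0 i)), fun ψ => ?_⟩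
  have hψ := SchwartzMap.nice ψ
  have hmono : ∀ i ∈ Finset.range (N + 1), rn ((i : ℝ) + r) (ψ : V → ℂ) ≤ rn ((N : ℝ) + r) (ψ : V → ℂ) :=
    fun i hi => rn_mono (by
      have : (i : ℝ) ≤ N := by exact_mod_cast Nat.lt_succ_iff.1 (Finset.mem_range.1 hi)
      linarith) hψ
  have hR := hu (toK' K ζ hζ (compF T Complex.reCLM ψ) (contDiff_compF T _ ψ))
  have hI := hu (toK' K ζ hζ (compF T Complex.imCLM ψ) (contDiff_compF T _ ψ))
  rw [ofSupportedIn_toK' hK] at hR hI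
  have hRb : ‖(u (mulSmooth ζ (compF T Complex.reCLM ψ) (contDiff_compF T _ ψ)) : ℝ)‖ ≤
      Cu * (∑ i ∈ Finset.range (N + 1), Dr i) * rn ((N : ℝ) + r) (ψ : V → ℂ) := by
    refine hR.trans ?_
    rw [mul_assoc, Finset.sum_mul]
    refine mul_le_mul_of_nonneg_left (Finset.sum_le_sum fun i hi => ?_) hCu
    exact (hDr i ψ).trans (mul_le_mul_of_nonneg_left (hmono i hi) (hDr0 i))
  have hIb : ‖(u (mulSmooth ζ (compF T Complex.imCLM ψ) (contDiff_compF T _ ψ)) : ℝ)‖ ≤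
      Cu * (∑ i ∈ Finset.range (N + 1), Di i) * rn ((N : ℝ) + r) (ψ : V → ℂ) := by
    refine hI.trans ?_
    rw [mul_assoc, Finset.sum_mul]
    refine mul_le_mul_of_nonneg_left (Finset.sum_le_sum fun i hi => ?_) hCu
    exact (hDi i ψ).trans (mul_le_mul_of_nonneg_left (hmono i hi) (hDi0 i))
  unfold fourierFun
  calc _ ≤ ‖((u (mulSmooth ζ (compF T Complex.reCLM ψ) (contDiff_compF T _ ψ)) : ℝ) : ℂ)‖ +
        ‖Complex.I * (u (mulSmooth ζ (compF T Complex.imCLM ψ) (contDiff_compF T _ ψ)) : ℝ)‖ :=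
        norm_sub_le _ _
    _ = ‖(u (mulSmooth ζ (compF T Complex.reCLM ψ) (contDiff_compF T _ ψ)) : ℝ)‖ +
        ‖(u (mulSmooth ζ (compF T Complex.imCLM ψ) (contDiff_compF T _ ψ)) : ℝ)‖ := by
        rw [norm_mul, Complex.norm_I, one_mul, Complex.norm_real, Complex.norm_real]
    _ ≤ Cu * (∑ i ∈ Finset.range (N + 1), Dr i) * rn ((N : ℝ) + r) (ψ : V → ℂ) +
        Cu * (∑ i ∈ Finset.range (N + 1), Di i) * rn ((N : ℝ) + r) (ψ : V → ℂ) := add_le_add hRb hIb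
    _ = _ := by rw [Finset.sum_add_distrib]; ring

/-- **Uniform Fourier sides**: for a compact `K ⊆ Ω` there is `M` such that every cutoff `ζ`
supported in `K` has a Fourier-side function `G ∈ Ĥ^{-M}` with `pairing G ψ = fourierFun u ζ T ψ`.
[folklore] -/
theorem exists_fourierSide_unif (u : 𝓓'(Ω, ℝ)) (K : Compacts E) (hK : (K : Set E) ⊆ Ω)
    (T : E →L[ℝ] V) : ∃ M : ℝ, ∀ ζ : 𝓓(Ω, ℝ), tsupport (ζ : E → ℝ) ⊆ K →
      ∃ G : V → ℂ, InH (-M) G ∧ ∀ ψ : 𝓢(V, ℂ), pairing G ψ = fourierFun u ζ T ψ := by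
  obtain ⟨M, hM⟩ := norm_fourierFun_le_unif u K hK T
  refine ⟨M, fun ζ hζ => ?_⟩
  obtain ⟨C, _, hC⟩ := hM ζ hζ
  obtain ⟨G, hG, hGp⟩ := exists_inH_pairing_eq (fourierFun u ζ T) (fourierFun_add u ζ T)
    (fourierFun_smul u ζ T) hC
  exact ⟨G, hG, hGp⟩

end Literature.Analysis.Hypoelliptic
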